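import Summits.BirchSwinnertonDyer.BirchSwinnertonDyer.Theorems.SignedLowerHalvesSprungLowerDivisibilityAtThreeRankZeroCommonZeros
import Summits.BirchSwinnertonDyer.BirchSwinnertonDyer.Theorems.SignedLowerHalvesSprungLowerDivisibilityAtThreeStubPeriodMu
import Literature.NumberTheory.EllipticCurves.Sprung2012.SharpFlatColemanKatoZeta
import Literature.NumberTheory.EllipticCurves.IwasawaAlgebraStructureProofs
import Literature.NumberTheory.EllipticCurves.AnalyticRank
import Literature.AnabelianGeometry.EtaleTheta.RootsOfUnityGaloisPrimePower
import HarnessLib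

/-!
# Crux K1 `SprungLowerDivisibilityAtThree` (stmt-BirchSwinnertonDyer-19875), line `chromatic-common-zeros`,
# stub S4b `stub_cyclotomicLowerRest`: the PER-PAIR VACUITY DOOR — a finite cyclotomic certificate plus
# analytic rank `≤ 1` leaves NO cyclotomic common zero off `(T)` (`--supports` 19875 as helper; brief 5 of the
# lead's `Lines/chromatic-common-zeros-BRIEFS.md`; closes nothing by itself)

Stub S4b (skeleton v3 `f5b8071484e3`, registered signature below) asks for the local Eisenstein inequality
`ℓ_𝔭 Λ/(G^•) ≤ ℓ_𝔭 X^•` at the height-one primes `𝔭` of `Λ = ℤ₃⟦T⟧` that are CYCLOTOMIC (`ω_n ∈ 𝔭` for some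
`n`), COMMON (contain the Néron-normalised `L`-function of every colour) and NOT the `(T)`-prime at analytic
rank `≤ 1` (that case is S4a, landed p608649). Algebra of `Λ`: a height-one prime containing
`ω_n = T · ∏_{1 ≤ j ≤ n} Φ_{p^j}(1+T)` contains `T` or some `Φ_{p^j}(1+T)`, `1 ≤ j ≤ n` (w3's
`ChromaticCommonZerosRankZero.exists_cyclotomic_comp_mem_of_omega_mem`), and `Φ_{p^j}(1+T)` is a PRIME ELEMENT
of `Λ` (§1: Eisenstein at `p` over `ℤ`, transported to `ℤ_p[X]`, hence irreducible and distinguished, hence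
prime in `Λ` by Weierstrass division — tree `IwasawaAlgebra.isPrime_span_coe`; the Eisenstein/irreducibility
inputs over `ℤ_p` are the tree's `Literature.AnabelianGeometry.EtaleTheta` lemmas), so such a `𝔭` IS
`(Φ_{p^j}(1+T))`. Therefore a per-pair CERTIFICATE «no `Φ_{p^j}(1+T)`, `j ≥ 1`, divides both `L♯` and `L♭`»
(finitely many `j` to check once the `λ`-invariants are known: `deg Φ_{p^j}(1+T) = 2·3^{j−1}`) confines the
cyclotomic common zeros to `(T)` (§2), and with `r_an ≤ 1` the hypothesis of S4b is never met: S4b holds for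
that pair outright (§3, `stub_cyclotomicLowerRest_of_cert`, the registered telescope with the two extra
hypotheses displayed; the period unit `h3` converts membership of the normalised `G^•` into membership of `L^•`).

* §1 `isDistinguishedAt_cyclotomic_comp_map`, `prime_cyclotomic_comp` (`Φ_{p^{k+1}}(1+T)` prime in `Λ`;
  Eisenstein-ness / irreducibility over `ℤ_p` are the tree's
  `Literature.AnabelianGeometry.EtaleTheta.cyclotomic_prime_pow_comp_X_add_one_isEisensteinAt_padicInt` /
  `…irreducible_cyclotomic_prime_pow_comp_padicInt`, imported).
* §2 `X_mem_of_cyclotomic_common_of_cert` (pure algebra: cyclotomic `𝔭` ∋ `A, B` + certificate ⟹ `T ∈ 𝔭`).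
* §3 `chromaticL_mem_of_normalised_mem` (unit period ratio), `stub_cyclotomicLowerRest_of_cert`.

No named fact beyond the displayed `h3`; K1, Sprung's main conjecture and BSD on leaf X8 are NOT proved by this
file. References: [Washington1997] §7.1 (Weierstrass preparation), §13.2; [Pollack2003] §6.5
(`ω_n = T ω_n⁺ ω_n⁻`); [Sprung2015] Conj. 5.6 / Prop. 5.2 (cyclotomic common zeros, the printed form of the
certificate's target); [KuriharaPollack2007] Problem 3.2.
-/

set_option autoImplicit false
-- justification: the mandated namespace `Summit.BirchSwinnertonDyer.BirchSwinnertonDyer.Theorems`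
-- (single-conjunct summit, Sub = Summit) repeats a segment by design (D-0017).
set_option linter.dupNamespace false

noncomputable section

open scoped Classical NumberField MatrixGroups ModularForm Polynomial

open NumberField IsDedekindDomain CongruenceSubgroup WeierstrassCurve Field Polynomial
  Literature.NumberTheory.EllipticCurves Literature.NumberTheory.EllipticCurves.ModularForms
  Literature.NumberTheory.EllipticCurves.ZpExtension Literature.NumberTheory.EllipticCurves.Sprung2017
  Literature.NumberTheory.EllipticCurves.Sprung2012 Literature.NumberTheory.EllipticCurves.Rank1Residual
  Literature.NumberTheory.EllipticCurves.IwasawaAlgebra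
  Summit.BirchSwinnertonDyer.BirchSwinnertonDyer.Theorems.ChromaticCommonZerosRankZero

namespace Summit.BirchSwinnertonDyer.BirchSwinnertonDyer.Theorems.ChromaticCommonZeros

/-! ### §1 `Φ_{p^{k+1}}(1+T)` is a prime element of `Λ = ℤ_p⟦T⟧` -/

section CyclotomicPrime

variable {p : ℕ} [Fact p.Prime]

omit [Fact p.Prime] in
/-- `Φ_{p^{k+1}}(1+X) ∈ ℤ[X]` is monic (the tree's copy in `EtaleTheta.RootsOfUnityGaloisPrimePower` is
private). [folklore] -/
theorem monic_cyclotomic_comp (k : ℕ) : ((cyclotomic (p ^ (k + 1)) ℤ).comp (X + 1)).Monic :=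
  (cyclotomic.monic _ ℤ).comp (monic_X_add_C 1) (by rw [← C_1, natDegree_X_add_C]; exact one_ne_zero)

/-- **`Φ_{p^{k+1}}(1+X)` is a distinguished polynomial over `ℤ_p`** (monic, lower coefficients in `𝔪`).
[cite: Washington1997, §7.1] -/
theorem isDistinguishedAt_cyclotomic_comp_map (k : ℕ) :
    (((cyclotomic (p ^ (k + 1)) ℤ).comp (X + 1)).map (Int.castRingHom ℤ_[p])).IsDistinguishedAt
      (IsLocalRing.maximalIdeal ℤ_[p]) :=
  { toIsWeaklyEisensteinAt :=
      (Literature.AnabelianGeometry.EtaleTheta.cyclotomic_prime_pow_comp_X_add_one_isEisensteinAt_padicInt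
        p k).isWeaklyEisensteinAt
    monic := (monic_cyclotomic_comp k).map _ }

/-- **`Φ_{p^{k+1}}(1+T)` is a PRIME ELEMENT of `Λ = ℤ_p⟦T⟧`**: the ideal it generates is prime
(`IwasawaAlgebra.isPrime_span_coe`: `Λ/(f) ≅ ℤ_p[X]/(f)` by Weierstrass division for a distinguished `f`, and
`f` is irreducible) and it is non-zero. Hence the height-one primes containing `ω_n` but not `T` are exactly the
`(Φ_{p^j}(1+T))`, `1 ≤ j ≤ n`. [cite: Washington1997, §7.1 and §13.2] -/
theorem prime_cyclotomic_comp (k : ℕ) :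
    Prime ((((cyclotomic (p ^ (k + 1)) ℤ).comp (X + 1)).map (Int.castRingHom ℤ_[p]) :
      IwasawaAlgebra p)) := by
  have hI := IwasawaAlgebra.isPrime_span_coe (p := p) (isDistinguishedAt_cyclotomic_comp_map (p := p) k)
    (Literature.AnabelianGeometry.EtaleTheta.irreducible_cyclotomic_prime_pow_comp_padicInt p k)
  have hne : ((((cyclotomic (p ^ (k + 1)) ℤ).comp (X + 1)).map (Int.castRingHom ℤ_[p]) :
      IwasawaAlgebra p)) ≠ 0 :=
    IwasawaAlgebra.coe_ne_zero_of_monic (p := p) ((monic_cyclotomic_comp k).map _)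
  exact (Ideal.span_singleton_prime hne).mp hI

end CyclotomicPrime

/-! ### §2 A certified pair has no cyclotomic common zero off `(T)` -/

section Door

variable {p : ℕ} [Fact p.Prime]

/-- **Cyclotomic certificate ⟹ every cyclotomic prime containing `A` and `B` contains `T`.** Let `𝔭` be a
height-one prime of `Λ = ℤ_p⟦T⟧` containing some `ω_n = (1+T)^{pⁿ} − 1` and two elements `A, B` (for the
line: the chromatic `L`-functions `L♯, L♭`). If NO `Φ_{p^j}(1+T)` with `j ≥ 1` divides both `A` and `B` (a
finite certificate per pair), then `T ∈ 𝔭`: otherwise `Φ_{p^j}(1+T) ∈ 𝔭` for some `1 ≤ j ≤ n`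
(`exists_cyclotomic_comp_mem_of_omega_mem`), `𝔭 = (Φ_{p^j}(1+T))` since that element is prime
(`prime_cyclotomic_comp`, `Ideal.eq_span_singleton_of_height_eq_one`), and `Φ_{p^j}(1+T)` would divide both.
[cite: Washington1997, §13.2] [cite: Pollack2003, §6.5 (display before Prop. 6.18)] -/
theorem X_mem_of_cyclotomic_common_of_cert (𝔭 : PrimeSpectrum (IwasawaAlgebra p))
    (h1 : 𝔭.asIdeal.height = 1)
    (hcyc : ∃ n : ℕ, ((cyclotomicOmega p n).map (Int.castRingHom ℤ_[p]) : PowerSeries ℤ_[p]) ∈ 𝔭.asIdeal)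
    {A B : IwasawaAlgebra p} (hA : A ∈ 𝔭.asIdeal) (hB : B ∈ 𝔭.asIdeal)
    (hcert : ∀ j : ℕ, 1 ≤ j →
      ¬ (((((cyclotomic (p ^ j) ℤ).comp (X + 1)).map (Int.castRingHom ℤ_[p]) : ℤ_[p][X]) :
            IwasawaAlgebra p) ∣ A ∧
         ((((cyclotomic (p ^ j) ℤ).comp (X + 1)).map (Int.castRingHom ℤ_[p]) : ℤ_[p][X]) :
            IwasawaAlgebra p) ∣ B)) :
    (PowerSeries.X : IwasawaAlgebra p) ∈ 𝔭.asIdeal := by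
  by_contra hT
  obtain ⟨n, hω⟩ := hcyc
  obtain ⟨j, hj1, -, hΦ⟩ := exists_cyclotomic_comp_mem_of_omega_mem p 𝔭 n hω hT
  obtain ⟨k, rfl⟩ : ∃ k, j = k + 1 := ⟨j - 1, by omega⟩
  have hprime := prime_cyclotomic_comp (p := p) k
  have heq := Ideal.eq_span_singleton_of_height_eq_one h1 hΦ hprime
  refine hcert (k + 1) hj1 ⟨?_, ?_⟩
  · exact Ideal.mem_span_singleton.mp (heq ▸ hA)
  · exact Ideal.mem_span_singleton.mp (heq ▸ hB)

/-! ### §3 Stub S4b for a certified pair of analytic rank `≤ 1` -/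

/-- **A normalised `G^•` in `𝔭` puts `L^•` in `𝔭`** on class X8: `ι G = C(ϖ)·ι L^•` with `ϖ ∈ ℤ₃ˣ` (period unit
`h3`, `norm_periodRatio_eq_one_of_classX8`), so `G = C(ϖ)·L^•` with `C(ϖ)` a unit of `Λ`, and a prime ideal
containing `G` contains `L^•`. [cite: GreenbergVatsal2000, §3 Rem. 3.4] -/
theorem chromaticL_mem_of_normalised_mem (h3 : realPeriodRat_eq_unit_mul_plusPeriod_three)
    (W : WeierstrassCurve ℚ) [W.IsElliptic] [W.IsGloballyMinimal] (p : ℕ) [Fact p.Prime]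
    (hX : ClassX8 W p) {N : ℕ} [NeZero N] (f : CuspForm (Gamma0 N) 2) (hf : IsNewformOf W f)
    (ϖ : ℚ) (hϖ : (ϖ : ℝ) * W.realPeriodRat = plusPeriod f) (Lsharp Lflat : IwasawaAlgebra p)
    (col : Chroma) {G : IwasawaAlgebra p}
    (hG : iwasawaToPowerSeries p G =
      PowerSeries.C (ϖ : ℚ_[p]) * iwasawaToPowerSeries p (chromaticL col Lsharp Lflat))
    (𝔭 : PrimeSpectrum (IwasawaAlgebra p)) (hG𝔭 : G ∈ 𝔭.asIdeal) :
    chromaticL col Lsharp Lflat ∈ 𝔭.asIdeal := by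
  have hnorm : ‖(ϖ : ℚ_[p])‖ = 1 := norm_periodRatio_eq_one_of_classX8 h3 W p hX f hf ϖ hϖ
  set u : ℤ_[p] := ⟨(ϖ : ℚ_[p]), hnorm.le⟩ with hu_def
  have hu : IsUnit u := PadicInt.isUnit_iff.mpr hnorm
  have hcoe : (u : ℚ_[p]) = (ϖ : ℚ_[p]) := rfl
  have hGeq : G = PowerSeries.C u * chromaticL col Lsharp Lflat :=
    iwasawaToPowerSeries_injective p (by rw [hG, iwasawaToPowerSeries_C_mul, hcoe])
  rw [hGeq] at hG𝔭
  rcases 𝔭.isPrime.mem_or_mem hG𝔭 with hC | hL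
  · exact absurd (Ideal.eq_top_of_isUnit_mem _ hC ((PowerSeries.C (R := ℤ_[p])).isUnit_map hu))
      𝔭.isPrime.ne_top
  · exact hL

/-- **Stub S4b `stub_cyclotomicLowerRest` of line `chromatic-common-zeros` for a CERTIFIED pair of analytic rank
`≤ 1` — VACUOUSLY.** The registered binder telescope of S4b (skeleton v3 `f5b8071484e3`: K1's telescope for
colour `•`, the dual datum `D` finitely generated torsion, normalised `G`, the joint package `I, Cs, Cf,
Cs.Z = Cf.Z`, a height-one CYCLOTOMIC prime `𝔭` with `¬ (T ∈ 𝔭 ∧ r_an ≤ 1)` containing the normalised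
`L`-function of every colour) with TWO EXTRA displayed hypotheses — `W.analyticRank ≤ 1` and the per-pair
cyclotomic certificate «no `Φ_{p^j}(1+T)`, `j ≥ 1`, divides both `L♯` and `L♭`» — and the period unit `h3`:
then the local Eisenstein inequality holds, because no such `𝔭` exists (`chromaticL_mem_of_normalised_mem`
puts `L♯, L♭ ∈ 𝔭`, `X_mem_of_cyclotomic_common_of_cert` gives `T ∈ 𝔭`, contradicting S4b's own hypothesis at
`r_an ≤ 1`). Together with S4a (`stub_cyclotomicLowerAtT`, p608649) this settles the cyclotomic part of the
common-zero locus for such a pair. No main-conjecture input. [cite: Washington1997, §13.2]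
[cite: Sprung2015, Prop. 5.2 and Conj. 5.6] [cite: KuriharaPollack2007, Problem 3.2] -/
theorem stub_cyclotomicLowerRest_of_cert (h3 : realPeriodRat_eq_unit_mul_plusPeriod_three) :
    ∀ (W : WeierstrassCurve ℚ) [W.IsElliptic] [W.IsGloballyMinimal] (p : ℕ) [Fact p.Prime]
      [ContinuousSMul ℤ_[p] (W.tateModule p)] [Module.Free ℤ_[p] (W.tateModule p)]
      [Module.Finite ℤ_[p] (W.tateModule p)],
      ClassX8 W p → W.analyticRank ≤ 1 →
    ∀ (col : Chroma) (κ : ZpExtension ℚ p) (γ : Field.absoluteGaloisGroup ℚ),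
      κ.IsCyclotomic → κ.IsTopGenerator γ → IsCyclotomicVariable p γ →
    ∀ (v : HeightOneSpectrum (𝓞 ℚ)), (p : 𝓞 ℚ) ∈ v.asIdeal →
    ∀ (g : Field.absoluteGaloisGroup (v.adicCompletion ℚ)),
      κ.IsTopGenerator (resGalOfEmb (closureEmb (K := ℚ) (v.adicCompletion ℚ)) g) →
    ∀ (cneg : localPoints W (v.adicCompletion ℚ)) (c : ℕ → localPoints W (v.adicCompletion ℚ)),
      IsHondaSystem κ (closureEmb (K := ℚ) (v.adicCompletion ℚ)) W (W.frobeniusTrace p) g cneg c →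
    ∀ (N : ℕ) (_ : NeZero N) (f : CuspForm (Gamma0 N) 2) (ϖ : ℚ) (Lsharp Lflat : IwasawaAlgebra p),
      IsNewformOf W f → (ϖ : ℝ) * W.realPeriodRat = plusPeriod f →
      IsSprungPair f p (W.frobeniusTrace p) Lsharp Lflat → chromaticL col Lsharp Lflat ≠ 0 →
      (∀ j : ℕ, 1 ≤ j →
        ¬ (((((cyclotomic (p ^ j) ℤ).comp (X + 1)).map (Int.castRingHom ℤ_[p]) : ℤ_[p][X]) :
              IwasawaAlgebra p) ∣ Lsharp ∧
           ((((cyclotomic (p ^ j) ℤ).comp (X + 1)).map (Int.castRingHom ℤ_[p]) : ℤ_[p][X]) :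
              IwasawaAlgebra p) ∣ Lflat)) →
    ∀ (D : SharpFlatSelmerDualData W κ γ (closureEmb (K := ℚ) (v.adicCompletion ℚ))
        (W.frobeniusTrace p) g c col) [Module.Finite (IwasawaAlgebra p) D.X],
      Module.IsTorsion (IwasawaAlgebra p) D.X →
    ∀ (G : IwasawaAlgebra p),
      iwasawaToPowerSeries p G =
        PowerSeries.C (ϖ : ℚ_[p]) * iwasawaToPowerSeries p (chromaticL col Lsharp Lflat) →
    ∀ (I : Kato2004.IwasawaH1Data W p κ γ)
      (Cs : SharpFlatColemanKatoData W p f ϖ κ γ (closureEmb (K := ℚ) (v.adicCompletion ℚ))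
        (W.frobeniusTrace p) g c Chroma.sharp I)
      (Cf : SharpFlatColemanKatoData W p f ϖ κ γ (closureEmb (K := ℚ) (v.adicCompletion ℚ))
        (W.frobeniusTrace p) g c Chroma.flat I),
      Cs.Z = Cf.Z →
    ∀ 𝔭 : PrimeSpectrum (IwasawaAlgebra p), 𝔭.asIdeal.height = 1 →
      (∃ n : ℕ, ((cyclotomicOmega p n).map (Int.castRingHom ℤ_[p]) : PowerSeries ℤ_[p]) ∈ 𝔭.asIdeal) →
      ¬ ((PowerSeries.X : IwasawaAlgebra p) ∈ 𝔭.asIdeal ∧ W.analyticRank ≤ 1) →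
      (∀ (col' : Chroma) (G' : IwasawaAlgebra p),
        iwasawaToPowerSeries p G' =
          PowerSeries.C (ϖ : ℚ_[p]) * iwasawaToPowerSeries p (chromaticL col' Lsharp Lflat) →
        G' ∈ 𝔭.asIdeal) →
      Module.lengthAt (IwasawaAlgebra p) (IwasawaAlgebra p ⧸ Ideal.span {G}) 𝔭 ≤
        Module.lengthAt (IwasawaAlgebra p) D.X 𝔭 := by
  intro W _ _ p _ _ _ _ hX hr col κ γ _ _ _ v _ g _ cneg c _ N hN f ϖ Lsharp Lflat hf hϖ _hSP _ hcert
    D _ _ G _ I Cs Cf _ 𝔭 h𝔭 hcyc hnot hcommon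
  haveI : NeZero N := hN
  exfalso
  -- both colours' normalised functions `C(ϖ)·L^•` lie in `𝔭`, hence `L♯, L♭ ∈ 𝔭`
  have hnorm : ‖(ϖ : ℚ_[p])‖ = 1 := norm_periodRatio_eq_one_of_classX8 h3 W p hX f hf ϖ hϖ
  set u : ℤ_[p] := ⟨(ϖ : ℚ_[p]), hnorm.le⟩ with hu_def
  have hcoe : (u : ℚ_[p]) = (ϖ : ℚ_[p]) := rfl
  have hmem : ∀ col' : Chroma, chromaticL col' Lsharp Lflat ∈ 𝔭.asIdeal := fun col' ↦
    chromaticL_mem_of_normalised_mem h3 W p hX f hf ϖ hϖ Lsharp Lflat col'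
      (G := PowerSeries.C u * chromaticL col' Lsharp Lflat) (by rw [iwasawaToPowerSeries_C_mul, hcoe]) 𝔭
      (hcommon col' _ (by rw [iwasawaToPowerSeries_C_mul, hcoe]))
  have hT : (PowerSeries.X : IwasawaAlgebra p) ∈ 𝔭.asIdeal :=
    X_mem_of_cyclotomic_common_of_cert 𝔭 h𝔭 hcyc (hmem Chroma.sharp) (hmem Chroma.flat) hcert
  exact hnot ⟨hT, hr⟩

end Door

end Summit.BirchSwinnertonDyer.BirchSwinnertonDyer.Theorems.ChromaticCommonZeros

end
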